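import Summits.ValiantsHypothesis.ValiantsHypothesis.Theorems.BarrierLeverChowBenchmarkPairsBlockPeelCert363
import Summits.ValiantsHypothesis.ValiantsHypothesis.Theorems.BarrierLeverChowBenchmarkPairsBlockPeelCertB364
import Summits.ValiantsHypothesis.ValiantsHypothesis.Theorems.BarrierLeverChowBenchmarkPairsBlockPeelCertB444
import Summits.ValiantsHypothesis.ValiantsHypothesis.Theorems.BarrierLeverChowBenchmarkPairsBlockPeelCertB573
import Summits.ValiantsHypothesis.ValiantsHypothesis.Theorems.BarrierLeverChowBenchmarkPairsBlockPeelCertB628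
import Summits.ValiantsHypothesis.ValiantsHypothesis.Theorems.BarrierLeverChowBenchmarkPairsBlockPeelCertBS183
import Summits.ValiantsHypothesis.ValiantsHypothesis.Theorems.BarrierLeverChowBenchmarkPairsBlockPeelConcatTable
import Summits.ValiantsHypothesis.ValiantsHypothesis.Theorems.BarrierLeverChowBenchmarkPairsDualisation

/-!
# Route BarrierLever — item 22038 `ChowBenchmarkPairs`, line `moore-peel`: RUNG 724 OF THE COMPUTATIONAL LANE — node #1
# `SegmentMeanValueAt h` and the item's own body for EVERY `h ≤ 724` (`Lean.ofReduceBool`)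

Helper file, **computational (`Lean.ofReduceBool`, inherited from the five block certificates)** (`--computational --supports
stmt-ValiantsHypothesis-22038`; cell valiant-natproofs, rung V4, 𝒟-side benchmark of record, line `moore_peel`, planner SUCCESSOR MANDATE
M2 (HOME/STATUS.md l.1824) in the RULING R43 pattern; seat val-np-p4 gen 30).  Closes NO item; definition-free.

ASSEMBLY.  THEOREM W's bad stages below `725` are `183, 364, 444, 573, 628` (`bad_le_724`, kernel table), all isolated; the ladder
`segmentMeanValueAt_of_le_724` (`…BlockPeelLadder`, p707833) needs the five tied 2-blocks `{b-1, b}` to have nonzero SYMBOLIC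
determinant.  These are certified — `{182,183}` by `det_blockMatrix_182_2_ne_zero` (p712340, inverse data + `native_decide`), the other
four by the DATA-FREE in-Lean LU certificates `det_blockMatrix_363_2_ne_zero` (pivoted, `…CertB364`), `det_blockMatrix_443_2_ne_zero`,
`det_blockMatrix_572_2_ne_zero`, `det_blockMatrix_627_2_ne_zero` (`…CertB444/B573/B628`; kits `…CertLU` / `…CertLUP`: one
`native_decide` each, NO data).  Hence:

* **`kernelPoisedAt_factorial_of_le_724_cert`**, **`segmentMeanValueAt_of_le_724_cert`** — node #1's statement VERBATIM for every
  `h ≤ 724`;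
* **`chowBenchmarkPairs_body_of_le_724_cert`** — the ROUTE DECL's body (`ChowBenchmarkPairs` is `∀ h, body h`) for every `h ≤ 724`, by
  the proved zeon dualisation `ChowBenchmarkDual.stub_dualisation` (p574420);
* CONJECTURE B3 instances through the certified doubles (`…BlockPeelConcat`): `conjB3_instance_181/182/183/362/363/442/443/571/572/
  626/627` (single ⊕ double or double ⊕ single; `183` through the bad-start double `{183,184}` of `…CertBS183`), so that with
  `conjB3_instance_of_le_180`, `conjB3_instance_of_ge_184_le_361` and the table instances, `det J^{!}(i,3) ≠ 0` holds BY NAME for EVERY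
  `1 ≤ i ≤ 361` (**`conjB3_instance_of_le_361`**, no exception) and for every `1 ≤ i ≤ 722` except the four bad-start triples
  `i ∈ {364, 444, 573, 628}` (`conjB3_instance_of_le_722`; `{444,445}` is a singular double, so `i = 444` needs a direct 3-block).

RANGES OF NODE #1 (RULING R43 (b), never merged): KERNEL `h ≤ 182` (p690790) · COMPUTATIONAL `h ≤ 724` (this file; was `363`, p712340/
p713529) · NUMERICAL `h ≤ 20 069` (hypotheses of `segmentMeanValueAt_of_blocks`) · CONJECTURAL ∀ h (`Stmt.conjB3` / `Stmt.conjPrefix`).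

WHAT THIS IS NOT: node #1 (∀ h) and the item are NOT closed; nothing on crux stmt-ValiantsHypothesis-14610 or on `VP` versus `VNP`.
-/

set_option linter.dupNamespace false

namespace Summit.ValiantsHypothesis.ValiantsHypothesis.Theorems.BarrierLever.MoorePeel

/-! ## 1. Rung 724 -/

/-- **`KernelPoisedAt k! h` for every `h ≤ 724`** (computational lane). -/
theorem kernelPoisedAt_factorial_of_le_724_cert (h : ℕ) (hh : h ≤ 724) : KernelPoisedAt Nat.factorial h :=
  kernelPoisedAt_factorial_of_le_724 det_blockMatrix_182_2_ne_zero det_blockMatrix_363_2_ne_zero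
    det_blockMatrix_443_2_ne_zero det_blockMatrix_572_2_ne_zero det_blockMatrix_627_2_ne_zero h hh

/-- **`SegmentMeanValueAt h` for EVERY `h ≤ 724`, VERBATIM (computational lane, `Lean.ofReduceBool`)** — node #1's statement on
`[0, 724]`: THEOREM W + the block peel theorem + the five certified tied 2-blocks. -/
theorem segmentMeanValueAt_of_le_724_cert (h : ℕ) (hh : h ≤ 724) :
    ∀ (r : ℕ) (u : Fin r → Finset (Fin h)), Function.Injective u → (∀ i, (u i).card ≤ 2) →
      (∀ S : Finset (Fin h), S.card ≤ 2 → ∃ i, u i = S) →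
      ∃ P : Fin h → Fin h → ℂ,
        (Matrix.of fun i j : Fin r =>
          ∑ g : (↥(benchCols h r j) → ↥(u i)), (∏ c : ↥(benchCols h r j), P (g c) c) *
            ∏ a : ↥(u i),
              ((Finset.univ.filter fun c : ↥(benchCols h r j) => g c = a).card.factorial : ℂ)).det ≠ 0 :=
  segmentMeanValueAt_of_le_724 det_blockMatrix_182_2_ne_zero det_blockMatrix_363_2_ne_zero
    det_blockMatrix_443_2_ne_zero det_blockMatrix_572_2_ne_zero det_blockMatrix_627_2_ne_zero h hh

/-- **The body of item 22038 `ChowBenchmarkPairs` for every `h ≤ 724`** (computational lane): segment mean-value unisolvence up to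
`724` transferred by the zeon dualisation `ChowBenchmarkDual.stub_dualisation`. -/
theorem chowBenchmarkPairs_body_of_le_724_cert (h : ℕ) (hh : h ≤ 724) :
    ∀ (r : ℕ) (u : Fin r → Finset (Fin h)), Function.Injective u → (∀ i, (u i).card ≤ 2) →
      (∀ S : Finset (Fin h), S.card ≤ 2 → ∃ i, u i = S) →
      ∃ B : Fin h → Fin h → ℂ,
        (Matrix.of fun i j : Fin r => MvPolynomial.coeff
          (∑ a ∈ u i, Finsupp.single (Fin.castAdd h a) 1 +
            ∑ c ∈ Finset.univ.filter (fun c : Fin h => Nat.testBit (j : ℕ) (c : ℕ)), Finsupp.single (Fin.natAdd h c) 1)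
          (∏ a : Fin h, (MvPolynomial.X (Fin.castAdd h a) + 1 +
            ∑ c : Fin h, MvPolynomial.C (B a c) * MvPolynomial.X (Fin.natAdd h c)))).det ≠ 0 :=
  ChowBenchmarkDual.stub_dualisation h (segmentMeanValueAt_of_le_724_cert h hh)

/-! ## 2. CONJECTURE B3 instances through the certified doubles -/

/-- Good single stages next to the bad ones (THEOREM W's table). -/
theorem det_kpeelMatrix_factorial_ne_zero_of_not_mem (j : ℕ) (h1 : 1 ≤ j) (hj : j ≤ 5000) (hnot : j ∉ badStagesLe5000) :
    (kpeelMatrix Nat.factorial j).det ≠ 0 := by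
  rw [kpeelMatrix_factorial]
  exact fun h0 => hnot ((det_peelMatrix_eq_zero_iff_mem_of_le_5000 j h1 hj).mp h0)

/-- `{181, 182, 183}`: single `181` ⊕ certified double `{182, 183}`. -/
theorem conjB3_instance_181 :
    (blockMatrix Nat.factorial 181 3 (fun s : Fin 3 => (MvPolynomial.X s : MvPolynomial (Fin 3) ℤ))).det ≠ 0 :=
  det_blockMatrix_three_ne_zero_of_single_double Nat.factorial (fun k => Nat.factorial_ne_zero k) 181 (by norm_num)
    (det_kpeelMatrix_factorial_ne_zero_of_not_mem 181 (by norm_num) (by norm_num) (by decide)) det_blockMatrix_182_2_ne_zero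

/-- `{182, 183, 184}`: certified double `{182, 183}` ⊕ single `184`. -/
theorem conjB3_instance_182 :
    (blockMatrix Nat.factorial 182 3 (fun s : Fin 3 => (MvPolynomial.X s : MvPolynomial (Fin 3) ℤ))).det ≠ 0 :=
  det_blockMatrix_three_ne_zero_of_double_single Nat.factorial (fun k => Nat.factorial_ne_zero k) 182 (by norm_num)
    det_blockMatrix_182_2_ne_zero (det_kpeelMatrix_factorial_ne_zero_of_not_mem 184 (by norm_num) (by norm_num) (by decide))

/-- `{183, 184, 185}`: certified bad-start double `{183, 184}` ⊕ single `185`. -/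
theorem conjB3_instance_183 :
    (blockMatrix Nat.factorial 183 3 (fun s : Fin 3 => (MvPolynomial.X s : MvPolynomial (Fin 3) ℤ))).det ≠ 0 :=
  det_blockMatrix_three_ne_zero_of_double_single Nat.factorial (fun k => Nat.factorial_ne_zero k) 183 (by norm_num)
    det_blockMatrix_183_2_ne_zero (det_kpeelMatrix_factorial_ne_zero_of_not_mem 185 (by norm_num) (by norm_num) (by decide))

/-- `{362, 363, 364}`: single ⊕ certified double. -/
theorem conjB3_instance_362 :
    (blockMatrix Nat.factorial 362 3 (fun s : Fin 3 => (MvPolynomial.X s : MvPolynomial (Fin 3) ℤ))).det ≠ 0 :=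
  det_blockMatrix_three_ne_zero_of_single_double Nat.factorial (fun k => Nat.factorial_ne_zero k) 362 (by norm_num)
    (det_kpeelMatrix_factorial_ne_zero_of_not_mem 362 (by norm_num) (by norm_num) (by decide)) det_blockMatrix_363_2_ne_zero

/-- `{363, 364, 365}`: certified double ⊕ single. -/
theorem conjB3_instance_363 :
    (blockMatrix Nat.factorial 363 3 (fun s : Fin 3 => (MvPolynomial.X s : MvPolynomial (Fin 3) ℤ))).det ≠ 0 :=
  det_blockMatrix_three_ne_zero_of_double_single Nat.factorial (fun k => Nat.factorial_ne_zero k) 363 (by norm_num)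
    det_blockMatrix_363_2_ne_zero (det_kpeelMatrix_factorial_ne_zero_of_not_mem 365 (by norm_num) (by norm_num) (by decide))

/-- `{442, 443, 444}`: single ⊕ certified double. -/
theorem conjB3_instance_442 :
    (blockMatrix Nat.factorial 442 3 (fun s : Fin 3 => (MvPolynomial.X s : MvPolynomial (Fin 3) ℤ))).det ≠ 0 :=
  det_blockMatrix_three_ne_zero_of_single_double Nat.factorial (fun k => Nat.factorial_ne_zero k) 442 (by norm_num)
    (det_kpeelMatrix_factorial_ne_zero_of_not_mem 442 (by norm_num) (by norm_num) (by decide)) det_blockMatrix_443_2_ne_zero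

/-- `{443, 444, 445}`: certified double ⊕ single. -/
theorem conjB3_instance_443 :
    (blockMatrix Nat.factorial 443 3 (fun s : Fin 3 => (MvPolynomial.X s : MvPolynomial (Fin 3) ℤ))).det ≠ 0 :=
  det_blockMatrix_three_ne_zero_of_double_single Nat.factorial (fun k => Nat.factorial_ne_zero k) 443 (by norm_num)
    det_blockMatrix_443_2_ne_zero (det_kpeelMatrix_factorial_ne_zero_of_not_mem 445 (by norm_num) (by norm_num) (by decide))

/-- `{571, 572, 573}`: single ⊕ certified double. -/
theorem conjB3_instance_571 :
    (blockMatrix Nat.factorial 571 3 (fun s : Fin 3 => (MvPolynomial.X s : MvPolynomial (Fin 3) ℤ))).det ≠ 0 :=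
  det_blockMatrix_three_ne_zero_of_single_double Nat.factorial (fun k => Nat.factorial_ne_zero k) 571 (by norm_num)
    (det_kpeelMatrix_factorial_ne_zero_of_not_mem 571 (by norm_num) (by norm_num) (by decide)) det_blockMatrix_572_2_ne_zero

/-- `{572, 573, 574}`: certified double ⊕ single. -/
theorem conjB3_instance_572 :
    (blockMatrix Nat.factorial 572 3 (fun s : Fin 3 => (MvPolynomial.X s : MvPolynomial (Fin 3) ℤ))).det ≠ 0 :=
  det_blockMatrix_three_ne_zero_of_double_single Nat.factorial (fun k => Nat.factorial_ne_zero k) 572 (by norm_num)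
    det_blockMatrix_572_2_ne_zero (det_kpeelMatrix_factorial_ne_zero_of_not_mem 574 (by norm_num) (by norm_num) (by decide))

/-- `{626, 627, 628}`: single ⊕ certified double. -/
theorem conjB3_instance_626 :
    (blockMatrix Nat.factorial 626 3 (fun s : Fin 3 => (MvPolynomial.X s : MvPolynomial (Fin 3) ℤ))).det ≠ 0 :=
  det_blockMatrix_three_ne_zero_of_single_double Nat.factorial (fun k => Nat.factorial_ne_zero k) 626 (by norm_num)
    (det_kpeelMatrix_factorial_ne_zero_of_not_mem 626 (by norm_num) (by norm_num) (by decide)) det_blockMatrix_627_2_ne_zero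

/-- `{627, 628, 629}`: certified double ⊕ single. -/
theorem conjB3_instance_627 :
    (blockMatrix Nat.factorial 627 3 (fun s : Fin 3 => (MvPolynomial.X s : MvPolynomial (Fin 3) ℤ))).det ≠ 0 :=
  det_blockMatrix_three_ne_zero_of_double_single Nat.factorial (fun k => Nat.factorial_ne_zero k) 627 (by norm_num)
    det_blockMatrix_627_2_ne_zero (det_kpeelMatrix_factorial_ne_zero_of_not_mem 629 (by norm_num) (by norm_num) (by decide))

/-- THEOREM W's table: the triples inside `[1, 725)` touching a bad stage are exactly those at
`i ∈ {b-2, b-1, b}`, `b ∈ {183, 364, 444, 573, 628}`. -/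
theorem near_bad_le_722 : ∀ i ∈ List.range 723, 1 ≤ i →
    (i ∈ badStagesLe5000 ∨ i + 1 ∈ badStagesLe5000 ∨ i + 2 ∈ badStagesLe5000) →
    i ∈ [181, 182, 183, 362, 363, 364, 442, 443, 444, 571, 572, 573, 626, 627, 628] := by
  decide +kernel

/-- **CONJECTURE B3 for every `1 ≤ i ≤ 722` except the four bad-start triples** `i ∈ {364, 444, 573, 628}` (kernel ⊕
computational): `det J^{!}(i,3)(Λ_0,Λ_1,Λ_2) ≠ 0` in `ℤ[Λ]`.  (The excluded triples `{b, b+1, b+2}` start at a bad stage: no sub-tiling through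
the certified doubles; `{444, 445}` is even a singular double — they are numerically nonsingular, kit j323569/j324405, not certified.) -/
theorem conjB3_instance_of_le_722 (i : ℕ) (hi : 1 ≤ i) (hi' : i ≤ 722)
    (hne : i ≠ 364 ∧ i ≠ 444 ∧ i ≠ 573 ∧ i ≠ 628) :
    (blockMatrix Nat.factorial i 3 (fun s : Fin 3 => (MvPolynomial.X s : MvPolynomial (Fin 3) ℤ))).det ≠ 0 := by
  by_cases hnear : i ∈ badStagesLe5000 ∨ i + 1 ∈ badStagesLe5000 ∨ i + 2 ∈ badStagesLe5000
  · have hmem := near_bad_le_722 i (List.mem_range.mpr (by omega)) hi hnear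
    simp only [List.mem_cons, List.not_mem_nil, or_false] at hmem
    obtain ⟨h2, h3, h4, h5⟩ := hne
    rcases hmem with rfl | rfl | rfl | rfl | rfl | rfl | rfl | rfl | rfl | rfl | rfl | rfl | rfl | rfl | rfl
    · exact conjB3_instance_181
    · exact conjB3_instance_182
    · exact conjB3_instance_183
    · exact conjB3_instance_362
    · exact conjB3_instance_363
    · exact absurd rfl h2
    · exact conjB3_instance_442
    · exact conjB3_instance_443
    · exact absurd rfl h3
    · exact conjB3_instance_571
    · exact conjB3_instance_572
    · exact absurd rfl h4
    · exact conjB3_instance_626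
    · exact conjB3_instance_627
    · exact absurd rfl h5
  · push Not at hnear
    obtain ⟨h0, h1, h2⟩ := hnear
    exact det_blockMatrix_factorial_X_ne_zero_of_not_mem_table i 3 hi (by omega) fun q hq => by
      interval_cases q
      · simpa using h0
      · exact h1
      · exact h2

/-- **CONJECTURE B3 BY NAME for EVERY `1 ≤ i ≤ 361`** (kernel for `i ∉ {181, 182, 183}`, computational there):
`det J^{!}(i,3)(Λ_0,Λ_1,Λ_2) ≠ 0` in `ℤ[Λ]`. -/
theorem conjB3_instance_of_le_361 (i : ℕ) (hi : 1 ≤ i) (hi' : i ≤ 361) :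
    (blockMatrix Nat.factorial i 3 (fun s : Fin 3 => (MvPolynomial.X s : MvPolynomial (Fin 3) ℤ))).det ≠ 0 :=
  conjB3_instance_of_le_722 i hi (by omega) ⟨by omega, by omega, by omega, by omega⟩

end Summit.ValiantsHypothesis.ValiantsHypothesis.Theorems.BarrierLever.MoorePeel
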